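import Summits.Ventures.LatticeQCDFlow.Scoring.U1SectorWeightFourierDerivatives
import Summits.Ventures.LatticeQCDFlow.Scoring.U1TorusPlaquetteBounds
import HarnessLib

/-!
# The second moment of the topological sectors of 2-d `U(1)` by Poisson summation: `Σ_k k² g_V(2πk)` in Bessel form

HONEST FRAMING: exact (Metropolis-corrected) sampling algorithms for lattice gauge theory;
figures of merit are autocorrelation/cost numbers at stated couplings and volumes; no
continuum-physics claim.

Venture `LatticeQCDFlow` (cell pub-lqcd), sub-topic `Scoring`; FANOUT row 5 (`s0-sun-a`), GEN-14.
NEW WORK of the cell (placement rule).  With the law `P(Q = k) = g_V(2πk)/Σ_j g_V(2πj)` of theory-2's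
topological charge on `(ℤ/L)²` (`Scoring/U1TorusTopologicalChargeLaw.lean`, `g_V = p_β^{*V}`,
`V = L²`) and the denominator `Σ_k g_V(2πk) = (2π)^{V−1} e^{−βV} Σ_n I_{|n|}(β)^V`
(`Scoring/U1TorusPartitionFunctionBessel.lean`), the second moment `⟨Q²⟩ = Σ_k k² P(Q = k)` needs
`Σ_k k² g_V(2πk)`.  POISSON SUMMATION (Mathlib's `Real.tsum_eq_tsum_fourier_of_rpow_decay_of_summable`)
applied to the continuous compactly supported `x ↦ (−2πix)² g_V(2πx)`, whose Fourier transform is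
`(𝓕 g_V(2π·))″` (`Real.iteratedDeriv_fourier`) with the values at the integers computed in
`Scoring/U1SectorWeightFourierDerivatives.lean`, gives, for every `V ≥ 3` and every real `β`:

* **`tsum_sq_mul_cconvPow_two_pi_mul`** / **`tsum_sq_mul_u1SectorWeight_toReal`** —
  `Σ_{k∈ℤ} k² g_V(2πk) = (V/(8π³)) Σ_{n∈ℤ} [f_n^{V−1} C_n − (V−1) f_n^{V−2} S_n²]`,
  `f_n = 2π e^{−β} I_{|n|}(β)`, `S_n = ∫_{−π}^{π} v sin(nv) e^{−β(1−cos v)} dv`,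
  `C_n = ∫_{−π}^{π} v² cos(nv) e^{−β(1−cos v)} dv`
  (the series on the right converges absolutely: `|S_n| ≤ 2π² e^{2|β|}`, `|C_n| ≤ 2π³ e^{2|β|}`,
  `|f_n| ≤ 2π e^{−β} I₀(|β|)` and `Σ_n |I_{|n|}(β)| = e^{|β|}`).

This is the `θ`-derivative route of the continuum literature (`⟨Q²⟩ = −∂²_θ log Z(θ)|₀`,
`Z(θ) = Σ_n f(n + θ/2π)^V`) made a theorem about the tree's objects; the companion
`Scoring/U1TorusTopologicalSusceptibilityBessel.lean` divides by the partition function.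
Elementary on top of Mathlib; nothing is cited (Poisson summation: Stein–Weiss VII.2.6 as in
Mathlib's docstring).
-/

noncomputable section

open MeasureTheory Set Real Filter Topology Complex Asymptotics
open scoped ENNReal Convolution FourierTransform
open Literature.Analysis.FunctionSpaces

namespace Summit.Ventures.LatticeQCDFlow.Scoring

variable (β : ℝ)

/-! ### 1. Uniform bounds for the incomplete Bessel integrals and summability -/

/-- `|S_n| ≤ 2π² e^{2|β|}`. -/
theorem abs_sinMoment_le (n : ℤ) :
    |∫ v in (-π)..π, v * Real.sin (n * v) * u1PlaqDensity β v| ≤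
      π * Real.exp (|β| * 2) * (2 * π) := by
  have h := intervalIntegral.norm_integral_le_of_norm_le_const (a := -π) (b := π)
    (C := π * Real.exp (|β| * 2)) (f := fun v => v * Real.sin (n * v) * u1PlaqDensity β v)
    fun v hv => by
      rw [Set.uIoc_of_le (by linarith [Real.pi_pos])] at hv
      have hv' : |v| ≤ π := abs_le.2 ⟨hv.1.le, hv.2⟩
      rw [Real.norm_eq_abs, abs_mul, abs_mul, abs_of_pos (u1PlaqDensity_pos β v)]
      have h1 : |v| * |Real.sin (n * v)| ≤ π * 1 :=
        mul_le_mul hv' (Real.abs_sin_le_one _) (abs_nonneg _) Real.pi_pos.le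
      calc |v| * |Real.sin (n * v)| * u1PlaqDensity β v ≤ π * 1 * Real.exp (|β| * 2) :=
            mul_le_mul h1 (u1PlaqDensity_le β v) (u1PlaqDensity_pos β v).le (by positivity)
        _ = π * Real.exp (|β| * 2) := by ring
  rwa [show π - -π = 2 * π by ring, abs_of_pos (by positivity : (0 : ℝ) < 2 * π),
    Real.norm_eq_abs] at h

/-- `|C_n| ≤ 2π³ e^{2|β|}`. -/
theorem abs_cosMoment_le (n : ℤ) :
    |∫ v in (-π)..π, v ^ 2 * Real.cos (n * v) * u1PlaqDensity β v| ≤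
      π ^ 2 * Real.exp (|β| * 2) * (2 * π) := by
  have h := intervalIntegral.norm_integral_le_of_norm_le_const (a := -π) (b := π)
    (C := π ^ 2 * Real.exp (|β| * 2)) (f := fun v => v ^ 2 * Real.cos (n * v) * u1PlaqDensity β v)
    fun v hv => by
      rw [Set.uIoc_of_le (by linarith [Real.pi_pos])] at hv
      have hv' : |v| ≤ π := abs_le.2 ⟨hv.1.le, hv.2⟩
      rw [Real.norm_eq_abs, abs_mul, abs_mul, abs_of_pos (u1PlaqDensity_pos β v), abs_pow]
      have h1 : |v| ^ 2 * |Real.cos (n * v)| ≤ π ^ 2 * 1 :=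
        mul_le_mul (pow_le_pow_left₀ (abs_nonneg v) hv' 2) (Real.abs_cos_le_one _) (abs_nonneg _)
          (by positivity)
      calc |v| ^ 2 * |Real.cos (n * v)| * u1PlaqDensity β v ≤ π ^ 2 * 1 * Real.exp (|β| * 2) :=
            mul_le_mul h1 (u1PlaqDensity_le β v) (u1PlaqDensity_pos β v).le (by positivity)
        _ = π ^ 2 * Real.exp (|β| * 2) := by ring
  rwa [show π - -π = 2 * π by ring, abs_of_pos (by positivity : (0 : ℝ) < 2 * π),
    Real.norm_eq_abs] at h

/-- `|f_n| = 2π e^{−β} |I_{|n|}(β)| ≤ 2π e^{−β} I₀(|β|)`. -/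
theorem abs_fourierValue_le (n : ℤ) :
    |2 * π * Real.exp (-β) * besselI n.natAbs β| ≤ 2 * π * Real.exp (-β) * besselI 0 |β| := by
  rw [abs_mul, abs_of_pos (by positivity : (0 : ℝ) < 2 * π * Real.exp (-β)),
    abs_besselI_eq_besselI_abs]
  exact mul_le_mul_of_nonneg_left (besselI_le_besselI_zero _ _) (by positivity)

/-- **Absolute convergence of the dual series**: the summand
`(2π)⁻¹ V [(V−1) f_n^{V−2} S_n² − f_n^{V−1} C_n]` (`V = m + 3`) is dominated by a constant multiple of
`|I_{|n|}(β)| = I_{|n|}(|β|)`, which is summable over `ℤ`. -/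
theorem summable_secondMoment_term (m : ℕ) :
    Summable fun n : ℤ => (2 * π)⁻¹ * ((m + 3 : ℕ) *
      ((m + 2 : ℕ) * (2 * π * Real.exp (-β) * besselI n.natAbs β) ^ (m + 1) *
          (∫ v in (-π)..π, v * Real.sin (n * v) * u1PlaqDensity β v) ^ 2 -
        (2 * π * Real.exp (-β) * besselI n.natAbs β) ^ (m + 2) *
          ∫ v in (-π)..π, v ^ 2 * Real.cos (n * v) * u1PlaqDensity β v)) := by
  set A : ℝ := 2 * π * Real.exp (-β) * besselI 0 |β| with hA
  set BS : ℝ := π * Real.exp (|β| * 2) * (2 * π) with hBS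
  set BC : ℝ := π ^ 2 * Real.exp (|β| * 2) * (2 * π) with hBC
  set K : ℝ := (2 * π)⁻¹ * ((m + 3 : ℕ) * ((m + 2 : ℕ) * A ^ m * BS ^ 2 + A ^ (m + 1) * BC)) with hK
  have hA0 : 0 ≤ A := by
    rw [hA]; exact le_trans (abs_nonneg _) (abs_fourierValue_le β 0)
  have hsum : Summable fun n : ℤ => K * (2 * π * Real.exp (-β) * besselI n.natAbs |β|) :=
    ((summable_besselI_natAbs |β|).mul_left (2 * π * Real.exp (-β))).mul_left K
  refine Summable.of_norm_bounded hsum fun n => ?_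
  set f : ℝ := 2 * π * Real.exp (-β) * besselI n.natAbs β with hf
  set S : ℝ := ∫ v in (-π)..π, v * Real.sin (n * v) * u1PlaqDensity β v with hS
  set C : ℝ := ∫ v in (-π)..π, v ^ 2 * Real.cos (n * v) * u1PlaqDensity β v with hC
  have hfabs : |f| = 2 * π * Real.exp (-β) * besselI n.natAbs |β| := by
    rw [hf, abs_mul, abs_of_pos (by positivity : (0 : ℝ) < 2 * π * Real.exp (-β)),
      abs_besselI_eq_besselI_abs]
  have hfA : |f| ≤ A := abs_fourierValue_le β n
  have hSB : |S| ≤ BS := abs_sinMoment_le β n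
  have hCB : |C| ≤ BC := abs_cosMoment_le β n
  have hf0 : 0 ≤ |f| := abs_nonneg _
  -- the two monomials
  have h1 : |((m + 2 : ℕ) : ℝ) * f ^ (m + 1) * S ^ 2| ≤ (m + 2 : ℕ) * A ^ m * BS ^ 2 * |f| := by
    rw [abs_mul, abs_mul, Nat.abs_cast, abs_pow, abs_pow, pow_succ]
    have hp : |f| ^ m ≤ A ^ m := pow_le_pow_left₀ hf0 hfA m
    have hs : |S| ^ 2 ≤ BS ^ 2 := pow_le_pow_left₀ (abs_nonneg _) hSB 2
    calc ((m + 2 : ℕ) : ℝ) * (|f| ^ m * |f|) * |S| ^ 2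
        ≤ ((m + 2 : ℕ) : ℝ) * (A ^ m * |f|) * BS ^ 2 := by
          gcongr
      _ = (m + 2 : ℕ) * A ^ m * BS ^ 2 * |f| := by ring
  have h2 : |f ^ (m + 2) * C| ≤ A ^ (m + 1) * BC * |f| := by
    rw [abs_mul, abs_pow, pow_succ]
    have hp : |f| ^ (m + 1) ≤ A ^ (m + 1) := pow_le_pow_left₀ hf0 hfA (m + 1)
    calc |f| ^ (m + 1) * |f| * |C| ≤ A ^ (m + 1) * |f| * BC := by gcongr
      _ = A ^ (m + 1) * BC * |f| := by ring
  rw [Real.norm_eq_abs, abs_mul, abs_mul, abs_of_pos (by positivity : (0 : ℝ) < (2 * π)⁻¹),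
    Nat.abs_cast, ← hfabs, hK]
  calc (2 * π)⁻¹ * (((m + 3 : ℕ) : ℝ) * |((m + 2 : ℕ) : ℝ) * f ^ (m + 1) * S ^ 2 - f ^ (m + 2) * C|)
      ≤ (2 * π)⁻¹ * (((m + 3 : ℕ) : ℝ) *
          ((m + 2 : ℕ) * A ^ m * BS ^ 2 * |f| + A ^ (m + 1) * BC * |f|)) := by
        gcongr
        exact (abs_sub _ _).trans (add_le_add h1 h2)
    _ = (2 * π)⁻¹ * ((m + 3 : ℕ) * ((m + 2 : ℕ) * A ^ m * BS ^ 2 + A ^ (m + 1) * BC)) * |f| := by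
        ring

/-! ### 2. Poisson summation -/

/-- `x ↦ g_V(2πx)` is continuous (`V = m + 3 ≥ 2`). -/
theorem continuous_cconvPow_two_pi_mul (m : ℕ) :
    Continuous fun x : ℝ => cconvPow β (m + 2) (2 * π * x) :=
  (continuous_cconvPow β (by omega : 1 ≤ m + 2)).comp (by fun_prop)

/-- `x ↦ g_V(2πx)` has compact support. -/
theorem hasCompactSupport_cconvPow_two_pi_mul (m : ℕ) :
    HasCompactSupport fun x : ℝ => cconvPow β (m + 2) (2 * π * x) :=
  (hasCompactSupport_cconvPow β (m + 2)).comp_homeomorph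
    (Homeomorph.mulLeft₀ (2 * π) (by positivity : (2 : ℝ) * π ≠ 0))

/-- **`𝓕[(−2πix)² g_V(2πx)] = (𝓕 g_V(2π·))″`** (Mathlib's `Real.iteratedDeriv_fourier`; the moments
`x^j g_V(2πx)`, `j ≤ 2`, are integrable, being continuous with compact support). -/
theorem fourier_sq_smul_cconvPow_two_pi_mul (m : ℕ) :
    𝓕 (fun x : ℝ => (-2 * π * I * x) ^ 2 • cconvPow β (m + 2) (2 * π * x)) =
      iteratedDeriv 2 (𝓕 (fun x : ℝ => cconvPow β (m + 2) (2 * π * x))) := by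
  have hint : ∀ n : ℕ, (n : ℕ∞) ≤ 2 →
      Integrable (fun x : ℝ => x ^ n • cconvPow β (m + 2) (2 * π * x)) := fun n _ => by
    have hc : Continuous fun x : ℝ => x ^ n • cconvPow β (m + 2) (2 * π * x) :=
      (continuous_pow n).smul (continuous_cconvPow_two_pi_mul β m)
    have hs : HasCompactSupport fun x : ℝ => x ^ n • cconvPow β (m + 2) (2 * π * x) :=
      (hasCompactSupport_cconvPow_two_pi_mul β m).mono fun x hx =>
        right_ne_zero_of_smul (Function.mem_support.mp hx)
    exact hc.integrable_of_hasCompactSupport hs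
  have h2 : ((2 : ℕ) : ℕ∞) ≤ 2 := le_of_eq (by norm_cast)
  exact (Real.iteratedDeriv_fourier (f := fun x : ℝ => cconvPow β (m + 2) (2 * π * x))
    (N := 2) (n := 2) hint h2).symm

/-- **`Σ_{k∈ℤ} (−2πik)² g_V(2πk) = Σ_{n∈ℤ} (𝓕 g_V(2π·))″(n)`** (`V = m + 3`): Poisson summation for the
continuous compactly supported `x ↦ (−2πix)² g_V(2πx)`, whose Fourier transform is the second
derivative of `𝓕 g_V(2π·)` and is summable over the integers by §1. -/
theorem tsum_sq_smul_cconvPow_two_pi_mul (m : ℕ) :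
    ∑' k : ℤ, (-2 * π * I * ((k : ℝ) : ℂ)) ^ 2 • cconvPow β (m + 2) (2 * π * (k : ℝ)) =
      ∑' n : ℤ, iteratedDeriv 2 (𝓕 (fun x : ℝ => cconvPow β (m + 2) (2 * π * x))) (n : ℝ) := by
  have hcontG : Continuous fun x : ℝ => (-2 * π * I * x) ^ 2 • cconvPow β (m + 2) (2 * π * x) :=
    (by fun_prop : Continuous fun x : ℝ => (-2 * π * I * x) ^ 2).smul
      (continuous_cconvPow_two_pi_mul β m)
  have hsuppG : HasCompactSupport fun x : ℝ => (-2 * π * I * x) ^ 2 • cconvPow β (m + 2) (2 * π * x) :=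
    (hasCompactSupport_cconvPow_two_pi_mul β m).mono fun x hx =>
      right_ne_zero_of_smul (Function.mem_support.mp hx)
  -- decay (compact support) and summability of the Fourier transform at the integers
  have hG0 : (fun x : ℝ => (-2 * π * I * x) ^ 2 • cconvPow β (m + 2) (2 * π * x)) =O[cocompact ℝ]
      fun x : ℝ => |x| ^ (-(2 : ℝ)) := by
    have hz : (fun x : ℝ => (-2 * π * I * x) ^ 2 • cconvPow β (m + 2) (2 * π * x)) =ᶠ[cocompact ℝ]
        0 := by
      rw [← Filter.coclosedCompact_eq_cocompact]
      exact hasCompactSupport_iff_eventuallyEq.mp hsuppG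
    exact (isBigO_zero (fun x : ℝ => |x| ^ (-(2 : ℝ))) (cocompact ℝ)).congr' hz.symm EventuallyEq.rfl
  have hsum : Summable fun n : ℤ =>
      𝓕 (fun x : ℝ => (-2 * π * I * x) ^ 2 • cconvPow β (m + 2) (2 * π * x)) n := by
    refine (Complex.summable_ofReal.2 (summable_secondMoment_term β m)).congr fun n => ?_
    rw [fourier_sq_smul_cconvPow_two_pi_mul, iteratedDeriv_two_fourier_cconvPow_intCast]
  -- Poisson summation at `x = 0`
  have hP := Real.tsum_eq_tsum_fourier_of_rpow_decay_of_summable hcontG one_lt_two hG0 hsum 0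
  simp only [zero_add, QuotientAddGroup.mk_zero, fourier_eval_zero, mul_one] at hP
  rw [fourier_sq_smul_cconvPow_two_pi_mul] at hP
  exact hP

/-- **THE SECOND MOMENT OF THE SECTOR WEIGHTS IN BESSEL FORM (complex form).**  For every `m` and real
`β` (`V = m + 3`):
`Σ_{k∈ℤ} k² p_β^{*V}(2πk) = (V/(8π³)) Σ_{n∈ℤ} [f_n^{V−1} C_n − (V−1) f_n^{V−2} S_n²]`. -/
theorem tsum_sq_mul_cconvPow_two_pi_mul (m : ℕ) :
    ∑' k : ℤ, ((k : ℂ) ^ 2) * cconvPow β (m + 2) (2 * π * k) =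
      (((m + 3 : ℕ) / (8 * π ^ 3) * ∑' n : ℤ,
        ((2 * π * Real.exp (-β) * besselI n.natAbs β) ^ (m + 2) *
            (∫ v in (-π)..π, v ^ 2 * Real.cos (n * v) * u1PlaqDensity β v) -
          (m + 2 : ℕ) * (2 * π * Real.exp (-β) * besselI n.natAbs β) ^ (m + 1) *
            (∫ v in (-π)..π, v * Real.sin (n * v) * u1PlaqDensity β v) ^ 2) : ℝ) : ℂ) := by
  have hπ : (π : ℝ) ≠ 0 := Real.pi_pos.ne'
  have hP := tsum_sq_smul_cconvPow_two_pi_mul β m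
  -- left side: pull out `(−2πi)² = −4π²`
  have hL : ∑' k : ℤ, (-2 * π * I * ((k : ℝ) : ℂ)) ^ 2 • cconvPow β (m + 2) (2 * π * (k : ℝ)) =
      (-(4 * π ^ 2) : ℂ) * ∑' k : ℤ, ((k : ℂ) ^ 2) * cconvPow β (m + 2) (2 * π * k) := by
    rw [← tsum_mul_left]
    refine tsum_congr fun k => ?_
    rw [smul_eq_mul, Complex.ofReal_intCast]
    have hI : I * I = -1 := Complex.I_mul_I
    linear_combination ((4 * π ^ 2 * (k : ℂ) ^ 2) * cconvPow β (m + 2) (2 * π * k)) * hI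
  -- right side: the explicit values, a real series
  have hR : ∑' n : ℤ, iteratedDeriv 2 (𝓕 (fun x : ℝ => cconvPow β (m + 2) (2 * π * x))) (n : ℝ) =
      ((-((2 * π)⁻¹ * (m + 3 : ℕ)) * ∑' n : ℤ,
        ((2 * π * Real.exp (-β) * besselI n.natAbs β) ^ (m + 2) *
            (∫ v in (-π)..π, v ^ 2 * Real.cos (n * v) * u1PlaqDensity β v) -
          (m + 2 : ℕ) * (2 * π * Real.exp (-β) * besselI n.natAbs β) ^ (m + 1) *
            (∫ v in (-π)..π, v * Real.sin (n * v) * u1PlaqDensity β v) ^ 2) : ℝ) : ℂ) := by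
    simp_rw [iteratedDeriv_two_fourier_cconvPow_intCast]
    rw [← Complex.ofReal_tsum, ← tsum_mul_left]
    congr 1
    refine tsum_congr fun n => ?_
    ring
  rw [hL, hR] at hP
  -- solve for the sum
  have h4 : (-(4 * π ^ 2) : ℂ) ≠ 0 := by
    rw [neg_ne_zero]; exact_mod_cast (by positivity : (0 : ℝ) < 4 * π ^ 2).ne'
  have hsol := congrArg (fun z : ℂ => (-(4 * π ^ 2) : ℂ)⁻¹ * z) hP
  simp only [← mul_assoc, inv_mul_cancel₀ h4, one_mul] at hsol
  rw [hsol]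
  push_cast
  field_simp
  ring

/-- **THE SECOND MOMENT OF THE SECTOR WEIGHTS IN BESSEL FORM.**  For every `V ≥ 3` and every real `β`,
with `g_V(2πk)` the sector weights of `Scoring/U1TorusTopologicalChargeLaw.lean`,
`S_n = ∫_{−π}^{π} v sin(nv) e^{−β(1−cos v)} dv`, `C_n = ∫_{−π}^{π} v² cos(nv) e^{−β(1−cos v)} dv` and
`f_n = 2π e^{−β} I_{|n|}(β)`:

  `Σ_{k∈ℤ} k² g_V(2πk) = (V/(8π³)) · Σ_{n∈ℤ} [f_n^{V−1} C_n − (V−1) f_n^{V−2} S_n²]`. -/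
theorem tsum_sq_mul_u1SectorWeight_toReal {V : ℕ} (hV : 3 ≤ V) :
    ∑' k : ℤ, (k : ℝ) ^ 2 * (u1SectorWeight β V k).toReal =
      V / (8 * π ^ 3) * ∑' n : ℤ,
        ((2 * π * Real.exp (-β) * besselI n.natAbs β) ^ (V - 1) *
            (∫ v in (-π)..π, v ^ 2 * Real.cos (n * v) * u1PlaqDensity β v) -
          (V - 1 : ℕ) * (2 * π * Real.exp (-β) * besselI n.natAbs β) ^ (V - 2) *
            (∫ v in (-π)..π, v * Real.sin (n * v) * u1PlaqDensity β v) ^ 2) := by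
  obtain ⟨m, rfl⟩ := Nat.exists_eq_add_of_le' hV
  apply Complex.ofReal_injective
  rw [Complex.ofReal_tsum]
  push_cast
  simp_rw [u1SectorWeight_toReal]
  rw [show m + 3 - 1 = m + 2 from rfl, tsum_sq_mul_cconvPow_two_pi_mul]
  push_cast
  ring

end Summit.Ventures.LatticeQCDFlow.Scoring
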